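import Summits.QuantumAdvantage.QuantumAdvantage.Theorems.RingMinor
import HarnessLib

/-!
# RingMinorLaw (decomp-qadv lens-2 g11; tree package 2/3 of node «MinorDial»): `𝔽₃`-DEGREE TRANSPORT along the Y-minor and the
UPWARD LAW for hard lengths

§1 the contracted strategy `contract P` of a degree-`≤ d` strategy `P` on `C_{m+3}` is a strategy on `C_{m+2}` of degree `≤ 4d+1`
(`contract_mem`; indicator `[P = 1] = 2P(1+P)`, XOR `A ⊕ B = A + B + AB`, the letter `+1`, affine substitution along `ins`) whose
output is `merge` of `P`'s output (`contract_out`).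
§2 `losing_step : N ∈ losing (4d+1) → N+1 ∈ losing d` (`N ≥ 2`), its iterate `losing_add` with the schedule `dialDeg`, and the
equivalence `allHard_iff_class`: «every `losing d` is co-finite» (= `ExactnessDial.NoPerfectConst3`) iff the same on ONE residue class
of lengths.  Supports items stmt-QuantumAdvantage-27380 / 27432.
-/

set_option linter.dupNamespace false

namespace Summit.QuantumAdvantage.QuantumAdvantage.Theorems.RingMinor

open Finset
open Literature.Computability.QuantumComplexity Literature.Computability.QuantumComplexity.RingHLF
open Literature.Computability.MetaComplexity Literature.Computability.MetaComplexity.Smolensky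
open Summit.QuantumAdvantage.AdviceFreeQNC0
open Summit.QuantumAdvantage.QuantumAdvantage.Theorems.RingPeriodFold

/-! ### §1 Degree transport: the contracted strategy has `[P = 1]`-degree `≤ 4d + 1` -/

section degree
variable {m : ℕ}

/-- the `{0,1}`-valued polynomial of a Boolean function on the cube. -/
def bind {n : ℕ} (f : (Fin n → Bool) → Bool) : CubeFn (ZMod 3) n := fun u => if f u then 1 else 0

/-- Ring-game helper `zmod3_cases` (lens-2 law package; see the module docstring). -/
theorem zmod3_cases (a : ZMod 3) : a = 0 ∨ a = 1 ∨ a = 2 := by revert a; decide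

/-- Ring-game helper `decide_bind_eq_one` (lens-2 law package; see the module docstring). -/
theorem decide_bind_eq_one {n : ℕ} (f : (Fin n → Bool) → Bool) (u : Fin n → Bool) : decide (bind f u = 1) = f u := by
  unfold bind
  rcases Bool.eq_false_or_eq_true (f u) with h | h <;> simp [h]

/-- Ring-game helper `one_mem_low` (lens-2 law package; see the module docstring). -/
theorem one_mem_low {n : ℕ} (d : ℕ) : (1 : CubeFn (ZMod 3) n) ∈ lowDeg (ZMod 3) n d := by
  rw [← mono_empty]; exact mono_mem_lowDeg (by simp)

/-- `σ(P) = 2·P·(1+P)`: the `{0,1}`-valued indicator polynomial of `[P = 1]` over `𝔽₃` (degree doubles). -/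
def sig {n : ℕ} (P : CubeFn (ZMod 3) n) : CubeFn (ZMod 3) n := (2 : ZMod 3) • (P * (1 + P))

/-- Ring-game helper `sig_eq_bind` (lens-2 law package; see the module docstring). -/
theorem sig_eq_bind {n : ℕ} (P : CubeFn (ZMod 3) n) : sig P = bind (fun u => decide (P u = 1)) := by
  funext u
  simp only [sig, bind, Pi.smul_apply, Pi.mul_apply, Pi.add_apply, Pi.one_apply, smul_eq_mul]
  rcases zmod3_cases (P u) with h | h | h <;> simp only [h] <;> decide

/-- Ring-game helper `sig_mem` (lens-2 law package; see the module docstring). -/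
theorem sig_mem {n d : ℕ} {P : CubeFn (ZMod 3) n} (hP : P ∈ lowDeg (ZMod 3) n d) : sig P ∈ lowDeg (ZMod 3) n (d + d) :=
  Submodule.smul_mem _ _ (mul_mem_lowDeg_add hP (Submodule.add_mem _ (one_mem_low d) hP))

/-- XOR of `{0,1}`-valued polynomials over `𝔽₃`: `A ⊕ B = A + B + A·B` (degrees ADD). -/
def bx {n : ℕ} (A B : CubeFn (ZMod 3) n) : CubeFn (ZMod 3) n := A + B + A * B

/-- Ring-game helper `bx_bind` (lens-2 law package; see the module docstring). -/
theorem bx_bind {n : ℕ} (f g : (Fin n → Bool) → Bool) : bx (bind f) (bind g) = bind (fun u => xor (f u) (g u)) := by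
  funext u; simp only [bx, bind, Pi.add_apply, Pi.mul_apply]
  rcases Bool.eq_false_or_eq_true (f u) with h | h <;> rcases Bool.eq_false_or_eq_true (g u) with h' | h' <;>
    simp only [h, h'] <;> decide

/-- Ring-game helper `bx_mem` (lens-2 law package; see the module docstring). -/
theorem bx_mem {n a b : ℕ} {A B : CubeFn (ZMod 3) n} (hA : A ∈ lowDeg (ZMod 3) n a) (hB : B ∈ lowDeg (ZMod 3) n b) :
    bx A B ∈ lowDeg (ZMod 3) n (a + b) :=
  Submodule.add_mem _ (Submodule.add_mem _ (lowDeg_mono (by omega) hA) (lowDeg_mono (by omega) hB)) (mul_mem_lowDeg_add hA hB)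

/-- Ring-game helper `bind_coord_eq` (lens-2 law package; see the module docstring). -/
theorem bind_coord_eq {n : ℕ} (j : Fin n) : bind (fun u : Fin n → Bool => u j) = mono (ZMod 3) {j} := by
  funext u; simp [bind, mono_apply]

/-- Ring-game helper `bind_coord_mem` (lens-2 law package; see the module docstring). -/
theorem bind_coord_mem {n : ℕ} (j : Fin n) : bind (fun u : Fin n → Bool => u j) ∈ lowDeg (ZMod 3) n 1 := by
  rw [bind_coord_eq]; exact mono_mem_lowDeg (by simp)

/-- Ring-game helper `bind_not_coord_mem` (lens-2 law package; see the module docstring). -/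
theorem bind_not_coord_mem {n : ℕ} (j : Fin n) : bind (fun u : Fin n → Bool => !u j) ∈ lowDeg (ZMod 3) n 1 := by
  have e : bind (fun u : Fin n → Bool => !u j) = 1 - mono (ZMod 3) {j} := by
    funext u; simp only [bind, mono_apply, Finset.mem_singleton, forall_eq, Pi.sub_apply, Pi.one_apply]
    rcases Bool.eq_false_or_eq_true (u j) with h | h <;> simp only [h] <;> decide
  rw [e]; exact Submodule.sub_mem _ (one_mem_low 1) (mono_mem_lowDeg (by simp))

/-- every coordinate of `ins u` is a polynomial of degree `≤ 1` in `u` (constant, a letter, or a flipped letter). -/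
theorem ins_coord_mem (i : Fin (m + 2 + 1)) :
    (fun u : Fin (m + 2) → Bool => if ins u i = true then (1 : ZMod 3) else 0) ∈ lowDeg (ZMod 3) (m + 2) 1 := by
  rcases Fin.eq_castSucc_or_eq_last i with ⟨j, rfl⟩ | rfl
  · by_cases hb : j = 0 ∨ j = Fin.last (m + 1)
    · have e : (fun u : Fin (m + 2) → Bool => if ins u (Fin.castSucc j) = true then (1 : ZMod 3) else 0) = bind (fun u => !u j) := by
        funext u; rw [ins_castSucc]; simp only [flipEnds, L, if_pos hb, bind]
      rw [e]; exact bind_not_coord_mem j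
    · have hb' : j ≠ 0 ∧ j ≠ Fin.last (m + 1) := not_or.mp hb
      have e : (fun u : Fin (m + 2) → Bool => if ins u (Fin.castSucc j) = true then (1 : ZMod 3) else 0) = bind (fun u => u j) := by
        funext u; rw [ins_castSucc, flipEnds_mid u hb'.1 hb'.2]; rfl
      rw [e]; exact bind_coord_mem j
  · have e : (fun u : Fin (m + 2) → Bool => if ins u (Fin.last (m + 2)) = true then (1 : ZMod 3) else 0) = 1 := by
      funext u; rw [ins_last]; simp
    rw [e]; exact one_mem_low 1

/-- pull a big-ring polynomial back along the minor: `(pull P)(u) = P(ins u)`. -/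
def pull (P : CubeFn (ZMod 3) (m + 2 + 1)) : CubeFn (ZMod 3) (m + 2) := fun u => P (ins u)

/-- Ring-game helper `pull_mem` (lens-2 law package; see the module docstring). -/
theorem pull_mem {d : ℕ} {P : CubeFn (ZMod 3) (m + 2 + 1)} (hP : P ∈ lowDeg (ZMod 3) (m + 2 + 1) d) :
    pull P ∈ lowDeg (ZMod 3) (m + 2) d :=
  Smolensky.comp_mem_lowDeg_of_coord ins ins_coord_mem hP

/-- **THE CONTRACTED STRATEGY** of a big-ring strategy `P`: pull every kept output back along the minor and XOR the
contracted vertex's output and the letter onto the two boundary outputs — as `{0,1}`-valued polynomials. -/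
def contract (P : Fin (m + 2 + 1) → CubeFn (ZMod 3) (m + 2 + 1)) : Fin (m + 2) → CubeFn (ZMod 3) (m + 2) := fun j =>
  if j = 0 ∨ j = L m then
    bx (bx (sig (pull (P (Fin.castSucc j)))) (sig (pull (P (Fin.last (m + 2)))))) (bind fun u => u j)
  else pull (P (Fin.castSucc j))

/-- **DEGREE LAW**: every output of the contracted strategy has degree `≤ 4d + 1`. -/
theorem contract_mem {d : ℕ} {P : Fin (m + 2 + 1) → CubeFn (ZMod 3) (m + 2 + 1)}
    (hP : ∀ i, P i ∈ lowDeg (ZMod 3) (m + 2 + 1) d) (j : Fin (m + 2)) : contract P j ∈ lowDeg (ZMod 3) (m + 2) (4 * d + 1) := by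
  unfold contract
  split_ifs with hb
  · have h := bx_mem (bx_mem (sig_mem (pull_mem (hP (Fin.castSucc j)))) (sig_mem (pull_mem (hP (Fin.last (m + 2))))))
      (bind_coord_mem j)
    have e : d + d + (d + d) + 1 = 4 * d + 1 := by ring
    rw [e] at h
    exact h
  · exact lowDeg_mono (by omega) (pull_mem (hP _))

/-- the contracted strategy's answers ARE the merged answers of `P` at the inserted pattern. -/
theorem contract_out (P : Fin (m + 2 + 1) → CubeFn (ZMod 3) (m + 2 + 1)) (u : Fin (m + 2) → Bool) :
    (fun j => decide (contract P j u = 1)) = merge (fun i => decide (P i (ins u) = 1)) u := by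
  funext j
  unfold contract merge
  by_cases hb : j = 0 ∨ j = L m
  · rw [if_pos hb, if_pos hb, sig_eq_bind, sig_eq_bind, bx_bind, bx_bind, decide_bind_eq_one]; rfl
  · rw [if_neg hb, if_neg hb]; rfl

end degree

/-! ### §2 THE MINOR LAW for hard lengths, its iterate, and «hardness on one residue class suffices» -/

section law

/-- **UPWARD LAW (Y-minor)**: if every strategy of degree `≤ 4d+1` loses somewhere on the odd class of `C_{m+2}`, then
every strategy of degree `≤ d` loses somewhere on the odd class of `C_{m+3}` — hard lengths propagate ONE STEP UP at
a degree discount `d ↦ 4d+1`. -/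
theorem losing_step' {m d : ℕ} (h : m + 2 ∈ losing (4 * d + 1)) : m + 2 + 1 ∈ losing d := by
  rw [mem_losing] at h ⊢
  intro P hP
  obtain ⟨x', hx', hn⟩ := h (contract P) (contract_mem hP)
  refine ⟨ins x', (oddZeros_ins_iff x').2 hx', fun hR => hn ?_⟩
  rw [rel_ins_iff] at hR
  rwa [contract_out]

/-- the same law indexed by the length `N ≥ 2`. -/
theorem losing_step {N d : ℕ} (hN : 2 ≤ N) (h : N ∈ losing (4 * d + 1)) : N + 1 ∈ losing d := by
  obtain ⟨m, rfl⟩ : ∃ m, N = m + 2 := ⟨N - 2, by omega⟩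
  exact losing_step' h

/-- the degree schedule of `k` minor steps: `dialDeg 0 d = d`, `dialDeg (k+1) d = dialDeg k (4d+1)` (so `≈ 4^k·d`). -/
def dialDeg : ℕ → ℕ → ℕ
  | 0, d => d
  | k + 1, d => dialDeg k (4 * d + 1)

/-- **k-STEP LAW**: `N ∈ losing (dialDeg k d) → N + k ∈ losing d`. -/
theorem losing_add {k : ℕ} : ∀ {N d : ℕ}, 2 ≤ N → N ∈ losing (dialDeg k d) → N + k ∈ losing d := by
  induction k with
  | zero => intro N d _ h; simpa [dialDeg] using h
  | succ k ih =>
    intro N d hN h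
    have h' : N + k ∈ losing (4 * d + 1) := ih hN h
    rw [show N + (k + 1) = (N + k) + 1 by omega]
    exact losing_step (by omega) h'

/-- `T`'s content on ONE residue class of lengths implies it everywhere («SPECIAL SIZES SUFFICE»): walk down from `n` to the nearest
class member `n − k` (`k < q`) at degree `dialDeg k d` and come back up by the `k`-step law. -/
theorem allHard_of_class {q : ℕ} (hq : 1 ≤ q) (r : ℕ) (H : ∀ d : ℕ, ∃ n₀ : ℕ, ∀ n ≥ n₀, n % q = r % q → n ∈ losing d) :
    ∀ d : ℕ, ∃ n₀ : ℕ, ∀ n ≥ n₀, n ∈ losing d := by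
  intro d
  choose n₀ hn₀ using fun k => H (dialDeg k d)
  refine ⟨(Finset.range q).sup n₀ + q + r + 2, fun n hn => ?_⟩
  obtain ⟨t, ht⟩ : ∃ t, n - r = q * t + (n - r) % q := ⟨(n - r) / q, (Nat.div_add_mod _ _).symm⟩
  set k := (n - r) % q with hk
  have hkq : k < q := Nat.mod_lt _ (by omega)
  have hk0 : n₀ k ≤ (Finset.range q).sup n₀ := Finset.le_sup (f := n₀) (Finset.mem_range.2 hkq)
  have hkle : k ≤ n - r := Nat.mod_le _ _
  have hn' : n = r + (q * t + k) := by rw [← ht]; omega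
  have e : n - k = r + q * t := by generalize q * t = M at hn' ⊢; omega
  have hmod : (n - k) % q = r % q := by rw [e, Nat.add_mul_mod_self_left]
  have hmem : n - k ∈ losing (dialDeg k d) := hn₀ k (n - k) (by omega) hmod
  have := losing_add (k := k) (by omega : 2 ≤ n - k) hmem
  rwa [Nat.sub_add_cancel (by omega : k ≤ n)] at this

/-- the trivial direction (restriction). -/
theorem class_of_allHard (q r : ℕ) (hT : ∀ d : ℕ, ∃ n₀ : ℕ, ∀ n ≥ n₀, n ∈ losing d) :
    ∀ d : ℕ, ∃ n₀ : ℕ, ∀ n ≥ n₀, n % q = r % q → n ∈ losing d :=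
  fun d => (hT d).imp fun _ h n hn _ => h n hn

/-- **EQUIV (special sizes suffice)**: «every `losing d` is co-finite» (= `ExactnessDial.NoPerfectConst3` verbatim) iff the same on the
single residue class `n ≡ r (mod q)`; e.g. deck lengths `q = 3, r = 0`, odd lengths `q = 2, r = 1`. -/
theorem allHard_iff_class {q : ℕ} (hq : 1 ≤ q) (r : ℕ) :
    (∀ d : ℕ, ∃ n₀ : ℕ, ∀ n ≥ n₀, n ∈ losing d) ↔ (∀ d : ℕ, ∃ n₀ : ℕ, ∀ n ≥ n₀, n % q = r % q → n ∈ losing d) :=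
  ⟨class_of_allHard q r, allHard_of_class hq r⟩

end law

end Summit.QuantumAdvantage.QuantumAdvantage.Theorems.RingMinor
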